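import Summits.HodgeConjecture.HodgeConjecture.Theorems.Ring2HypothesesDescentAbsoluteExteriorStabilizerProducts
import HarnessLib

/-!
# Ring 2 — hypotheses layer, descent axis: PRODUCTS OF POWERS — `G_P(B^{m+1} × C^{n+1}) = G_P(B × C)` BLOCK-DIAGONALLY FOR EVERY
# ADMISSIBLE SYSTEM (`S`, `G¹_alg`, `G¹_mot`, `G¹_AH`; `Hg` is the Literature's), Tannaka-free

HONEST FRAMING (page 1, verbatim the cell's standing line): **research route conditional on HC_CM; not a corollary;
Q11.4-sentence-2 already refuted in dim ≥ 3.** Nothing in this file proves a case of the Hodge conjecture; nothing discharges the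
binder of record b06 `Ring2.Hypotheses.AbsoluteHodgeImpliesAlgebraicAV` (OPEN); the binder table's numbers do not move. `HC_CM`,
`HC_AV` and row b06 are ABSENT from this file. Hodge ladder STAGE 3, `BINDER-OWNERS.md` row **b06**, seat `ring2-b06` (gen 87).
Sequel of `…ExteriorStabilizerProducts` (this gen: `G_P(B × C) ≤ G_P(B) × G_P(C)`, transfer along intertwining retractions) and of the
powers files (gen 86: `G_P(A^{r+1}) = G_P(A)` diagonally); the Hodge-group case is the Literature's `Milne1999/HodgeGroupProductsPowers`
(Moonen–Zarhin 1999 §1: "we can identify `Hg(X_1^{n_1} × ⋯ × X_r^{n_r})` with `Hg(X_1 × ⋯ × X_r)`", `r = 2`; this seat, same gen);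
the retractions `B^{m+1} ⊂ B^{m+n+2} ⊃ C^{n+1}` are re-derived here (private) from the lane's `exists_retraction_powSucc_prod_powSucc`.

THE SETTING (as in the companions): class notion `P`, group `G_P(Y) := powClassStabilizer Y.X (P on the powers of Y)`, ADMISSIBLE =
the displayed hypotheses `hS` ((S) `G_P ≤ S`) and `hP` ((Π) pull-back stability); no definition.

* (namespace `StabilizerProductsPowers`) **`G_P(B^{m+1} × C^{n+1}) = G_P(B × C)` BLOCK-DIAGONALLY** for admissible `P`:
  `⊇` `diagPow_prodBlockDiagEquiv_mem` — if `⋀•(u ⊕ v) ∈ G_P(B × C)` then `⋀•(u^{⊕(m+1)} ⊕ v^{⊕(n+1)}) ∈ G_P(B^{m+1} × C^{n+1})` (up to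
  `(B × C)^{N+1}`, `N = m + n + 1`, by the powers theorem; shuffle; retract); `⊆` `exists_of_mem` — every element of
  `G_P(B^{m+1} × C^{n+1})` has this form with `⋀•(u ⊕ v) ∈ G_P(B × C)` (blocks by `…StabilizerProducts` §2, diagonal by the powers
  theorem, and transfer down along `B × C ⊂ B^{m+1} × C^{n+1}`); `mem_iff`.
* §2 instances: `S`, `G¹_alg`, `G¹_mot` FACT-FREE; `G¹_AH` mod c23 + c35 + (E) — THE ROW'S GROUP:
  **`G¹_AH(B^{m+1} × C^{n+1}) = G¹_AH(B × C)` block-diagonally**.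

HONEST COLUMN. No definition, no NEW named fact, no sorry; displayed facts c23 (`hZ`), c35 (`hN`), (E) (`hex`) in the `G¹_AH` instance
only. As a SLICE nothing is new; new is the GROUP statement (every inclusion / equality of the tower at `B^{m+1} × C^{n+1}` may be read
at `B × C`). NOT obtained: `r ≥ 3` factors; equalities `G_P(B × C) = G_P(B) × G_P(C)` (need product-span hypotheses, companion §3);
anything deciding the row. PRESEARCH as in the companions (Moonen–Zarhin §1 re-opened; certification by assembly, no novelty claimed).
References (bib keys): MoonenZarhin1999LowDim (§1, §3 (3.1)), Milne1999LefschetzClasses (§1 p. 643, Cor. 4.7), Andre1996Motifs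
(§4.6 (ii), §6.2–6.3), Deligne1982HodgeCycles (I §3; §2 Ex. 2.1 (a)), CharlesSchnell2014Notes ((11.2.2)–(11.2.3)),
LangeBirkenhake1992 (Thm. 4.2.1), HatcherAT2002 (§3.2 Thm. 3.16).
-/

noncomputable section

-- every declaration of this problem lives in `Summit.HodgeConjecture.HodgeConjecture.…` (summit = sub-problem)
set_option linter.dupNamespace false

namespace Summit.HodgeConjecture.HodgeConjecture.Ring2.Hypotheses

open CategoryTheory AlgebraicGeometry MonoidalCategory CartesianMonoidalCategory
open Literature.AlgebraicGeometry Literature.AlgebraicGeometry.Motives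
open Literature.AlgebraicGeometry.HodgeTheory
open Literature.AlgebraicTopology.SingularHomology
open Literature.Barriers.HodgeConjecture (divisorClassesSpan)
open Literature.AlgebraicGeometry.Milne1999 (specialLefschetzGroup centralizerGroup diagPow diagPowExterior exteriorPullbackEquiv
  prodBlockDiagEquiv)

/-! ## §0 Plumbing (generic objects, private): products and composites of retractions, blockwise intertwining -/

/-- A product of retractions is a retraction. [folklore] -/
private theorem retraction_prod {X X' Y Y' : AbelianVariety ℂ} {ι : X ⟶ X'} {π : X' ⟶ X} (h : ι ≫ π = 𝟙 X) {ι₀ : Y ⟶ Y'}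
    {π₀ : Y' ⟶ Y} (h₀ : ι₀ ≫ π₀ = 𝟙 Y) :
    AbelianVariety.prodLift (AbelianVariety.fst X Y ≫ ι) (AbelianVariety.snd X Y ≫ ι₀) ≫
        AbelianVariety.prodLift (AbelianVariety.fst X' Y' ≫ π) (AbelianVariety.snd X' Y' ≫ π₀) = 𝟙 (X.prod Y) := by
  refine AbelianVariety.prod_hom_ext ?_ ?_
  · rw [Category.assoc, AbelianVariety.prodLift_fst, ← Category.assoc, AbelianVariety.prodLift_fst, Category.assoc, h,
      Category.id_comp, Category.comp_id]
  · rw [Category.assoc, AbelianVariety.prodLift_snd, ← Category.assoc, AbelianVariety.prodLift_snd, Category.assoc, h₀,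
      Category.id_comp, Category.comp_id]

/-- A product `π × π₀` of homomorphisms intertwining `H¹`-automorphisms blockwise intertwines the block sums.
[cite: Milne1999LefschetzClasses, §1 p. 643] [cite: HatcherAT2002, §3.2 Thm. 3.16] -/
private theorem intertwine_prod {X X' Y Y' : AbelianVariety ℂ} (π : X' ⟶ X) (π₀ : Y' ⟶ Y)
    (UX' : complexBetti X'.X 1 ≃ₗ[ℂ] complexBetti X'.X 1) (UX : complexBetti X.X 1 ≃ₗ[ℂ] complexBetti X.X 1)
    (UY' : complexBetti Y'.X 1 ≃ₗ[ℂ] complexBetti Y'.X 1) (UY : complexBetti Y.X 1 ≃ₗ[ℂ] complexBetti Y.X 1)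
    (hX : ∀ q : complexBetti X.X 1, UX' (complexBetti.map π.hom.hom.hom 1 q) = complexBetti.map π.hom.hom.hom 1 (UX q))
    (hY : ∀ z : complexBetti Y.X 1, UY' (complexBetti.map π₀.hom.hom.hom 1 z) = complexBetti.map π₀.hom.hom.hom 1 (UY z))
    (y : complexBetti (X.prod Y).X 1) :
    prodBlockDiagEquiv UX' UY' (complexBetti.map
        (AbelianVariety.prodLift (AbelianVariety.fst X' Y' ≫ π) (AbelianVariety.snd X' Y' ≫ π₀)).hom.hom.hom 1 y) =
      complexBetti.map (AbelianVariety.prodLift (AbelianVariety.fst X' Y' ≫ π) (AbelianVariety.snd X' Y' ≫ π₀)).hom.hom.hom 1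
        (prodBlockDiagEquiv UX UY y) :=
  Milne1999.apply_map_eq_map_prodBlockDiagEquiv _ _ _ _
    (fun q ↦ by rw [AbelianVariety.prodLift_fst, Milne1999.complexBetti_map_comp_apply, Milne1999.complexBetti_map_comp_apply,
      Milne1999.prodBlockDiagEquiv_apply_map_fst, hX])
    (fun z ↦ by rw [AbelianVariety.prodLift_snd, Milne1999.complexBetti_map_comp_apply, Milne1999.complexBetti_map_comp_apply,
      Milne1999.prodBlockDiagEquiv_apply_map_snd, hY]) y

/-- Retractions compose. [folklore] -/
private theorem retraction_comp {X Y Z : AbelianVariety ℂ} {ι : X ⟶ Y} {π : Y ⟶ X} (h : ι ≫ π = 𝟙 X) {ι' : Y ⟶ Z} {π' : Z ⟶ Y}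
    (h' : ι' ≫ π' = 𝟙 Y) : (ι ≫ ι') ≫ (π' ≫ π) = 𝟙 X := by
  rw [Category.assoc, ← Category.assoc ι', h', Category.id_comp, h]

/-- `B^{m+1}` is a retract of `B^{m+n+2}` (`B^{m+1} ⊂ B^{m+1} × B^{n+1} ⊂ B^{m+n+2}`). [cite: LangeBirkenhake1992, Thm. 4.2.1] -/
private theorem exists_retraction_left (B : AbelianVariety ℂ) (m n : ℕ) :
    ∃ (ι : B.powSucc m ⟶ B.powSucc (m + n + 1)) (π : B.powSucc (m + n + 1) ⟶ B.powSucc m), ι ≫ π = 𝟙 _ := by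
  obtain ⟨ι, π, h⟩ := Milne1999.exists_retraction_powSucc_prod_powSucc B m n
  exact ⟨AbelianVariety.prodLift (𝟙 _) (0 : B.powSucc m ⟶ B.powSucc n) ≫ ι, π ≫ AbelianVariety.fst _ _,
    retraction_comp (AbelianVariety.prodLift_fst _ _) h⟩

/-- `C^{n+1}` is a retract of `C^{m+n+2}` (`C^{n+1} ⊂ C^{m+1} × C^{n+1} ⊂ C^{m+n+2}`). [cite: LangeBirkenhake1992, Thm. 4.2.1] -/
private theorem exists_retraction_right (C : AbelianVariety ℂ) (m n : ℕ) :
    ∃ (ι : C.powSucc n ⟶ C.powSucc (m + n + 1)) (π : C.powSucc (m + n + 1) ⟶ C.powSucc n), ι ≫ π = 𝟙 _ := by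
  obtain ⟨ι, π, h⟩ := Milne1999.exists_retraction_powSucc_prod_powSucc C m n
  exact ⟨AbelianVariety.prodLift (0 : C.powSucc n ⟶ C.powSucc m) (𝟙 _) ≫ ι, π ≫ AbelianVariety.snd _ _,
    retraction_comp (AbelianVariety.prodLift_snd _ _) h⟩

/-! ## §1 The generic theorem -/

namespace StabilizerProductsPowers

variable {P : ∀ (_N : ℕ) (Y : SchemeOver ℂ) (p : ℕ), Set (complexBetti Y (2 * p))}
variable (hS : ∀ B : AbelianVariety ℂ,
    powClassStabilizer B.X (fun a p ↦ P (cartesianPowDim B.dim a) (cartesianPow B.X (a + 1)) p) ≤ specialLefschetzGroup B.dim B.X)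
  (hP : ∀ ⦃B B' : AbelianVariety ℂ⦄ (f : B ⟶ B') ⦃p : ℕ⦄ ⦃c : complexBetti B'.X (2 * p)⦄,
    c ∈ P B'.dim B'.X p → complexBetti.map f.hom.hom.hom (2 * p) c ∈ P B.dim B.X p)
include hS hP

/-- **`⊇`: if `⋀•(u ⊕ v) ∈ G_P(B × C)` then `⋀•(u^{⊕(m+1)} ⊕ v^{⊕(n+1)}) ∈ G_P(B^{m+1} × C^{n+1})`** (admissible `P`). With `N = m + n + 1`:
`⋀•((u ⊕ v)^{⊕(N+1)}) ∈ G_P((B × C)^{N+1})` (powers, gen 86); the shuffle `(B × C)^{N+1} ≅ B^{N+1} × C^{N+1}` intertwines it with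
`⋀•(u^{⊕(N+1)} ⊕ v^{⊕(N+1)})`, and the product of the retractions `B^{N+1} → B^{m+1}`, `C^{N+1} → C^{n+1}` — which intertwine the diagonals
because `u ∈ C(B) ⊗ ℂ`, `v ∈ C(C) ⊗ ℂ` ((S) on `B × C` and Milne §1 p. 643) — transfers it (companion §1).
[cite: MoonenZarhin1999LowDim, §1] [cite: Milne1999LefschetzClasses, §1 p. 643] [cite: Andre1996Motifs, §6.2 (p. 31)] -/
theorem diagPow_prodBlockDiagEquiv_mem (B C : AbelianVariety ℂ) (m n : ℕ)
    {u : complexBetti B.X 1 ≃ₗ[ℂ] complexBetti B.X 1} {v : complexBetti C.X 1 ≃ₗ[ℂ] complexBetti C.X 1}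
    (huv : (fun k ↦ exteriorPullbackEquiv (AbelianVariety.hasExteriorCohomologyH1_complexPoints (B.prod C)) (prodBlockDiagEquiv u v) k) ∈
      powClassStabilizer (B.prod C).X (fun a p ↦ P (cartesianPowDim (B.prod C).dim a) (cartesianPow (B.prod C).X (a + 1)) p)) :
    (fun k ↦ exteriorPullbackEquiv (AbelianVariety.hasExteriorCohomologyH1_complexPoints ((B.powSucc m).prod (C.powSucc n)))
        (prodBlockDiagEquiv (diagPow B u m) (diagPow C v n)) k) ∈
      powClassStabilizer ((B.powSucc m).prod (C.powSucc n)).X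
        (fun a p ↦ P (cartesianPowDim ((B.powSucc m).prod (C.powSucc n)).dim a) (cartesianPow ((B.powSucc m).prod (C.powSucc n)).X (a + 1)) p) := by
  -- `u ⊕ v ∈ C(B × C)`, so `u ∈ C(B)`, `v ∈ C(C)`
  have h1 : prodBlockDiagEquiv u v ∈ centralizerGroup (B.prod C) := by
    have h := (StabilizerPowers.eq_exteriorPullbackEquiv_and_mem_centralizerGroup (hS (B.prod C)) huv).2
    rwa [Milne1999.exteriorPullbackEquiv_one_eq] at h
  have huC : u ∈ centralizerGroup B := by
    rw [← Milne1999.centralizerGroup.restrictFstHom_prodBlockDiagEquiv h1]; exact Milne1999.centralizerGroup.restrictFstHom_mem _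
  have hvC : v ∈ centralizerGroup C := by
    rw [← Milne1999.centralizerGroup.restrictSndHom_prodBlockDiagEquiv h1]; exact Milne1999.centralizerGroup.restrictSndHom_mem _
  -- up to `(B × C)^{N+1}`
  have hN := StabilizerPowers.diagPowExterior_mem_powSucc hS hP huv (m + n + 1)
  rw [Milne1999.exteriorPullbackEquiv_one_eq] at hN
  -- shuffle and retract
  obtain ⟨σ, τ, -, hτσ, hint⟩ := Milne1999.exists_shuffle_powSucc_prod B C (m + n + 1)
  obtain ⟨ιB, πB, hB⟩ := exists_retraction_left B m n
  obtain ⟨ιC, πC, hC⟩ := exists_retraction_right C m n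
  refine StabilizerProducts.mem_of_retraction hS hP
    (AbelianVariety.prodLift (AbelianVariety.fst _ _ ≫ ιB) (AbelianVariety.snd _ _ ≫ ιC) ≫ τ)
    (σ ≫ AbelianVariety.prodLift (AbelianVariety.fst _ _ ≫ πB) (AbelianVariety.snd _ _ ≫ πC))
    (retraction_comp (retraction_prod hB hC) hτσ) (fun y ↦ ?_) hN
  rw [Milne1999.complexBetti_map_comp_apply, Milne1999.complexBetti_map_comp_apply, hint u v,
    intertwine_prod πB πC (diagPow B u (m + n + 1)) (diagPow B u m) (diagPow C v (m + n + 1)) (diagPow C v n)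
      (fun q ↦ Milne1999.diagPow_map_powSucc huC _ _ πB q) (fun z ↦ Milne1999.diagPow_map_powSucc hvC _ _ πC z) y]

/-- **`⊆`: every element of `G_P(B^{m+1} × C^{n+1})` is `⋀•(u^{⊕(m+1)} ⊕ v^{⊕(n+1)})` with `⋀•(u ⊕ v) ∈ G_P(B × C)`** (admissible `P`): blocks
`⋀•U ∈ G_P(B^{m+1})`, `⋀•V ∈ G_P(C^{n+1})` (companion §2), `U = u^{⊕(m+1)}`, `V = v^{⊕(n+1)}` with `⋀•u ∈ G_P(B)`, `⋀•v ∈ G_P(C)` (powers,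
gen 86), and `⋀•(u ⊕ v) ∈ G_P(B × C)` by transfer along the sections `B × C ⊂ B^{m+1} × C^{n+1}` of the last factors.
[cite: MoonenZarhin1999LowDim, §1 and §3 (3.1)] [cite: Milne1999LefschetzClasses, §1 p. 643 and Cor. 4.7] [cite: Andre1996Motifs, §6.2 (p. 31)] -/
theorem exists_of_mem (B C : AbelianVariety ℂ) (m n : ℕ)
    {g' : ∀ k : ℕ, complexBetti ((B.powSucc m).prod (C.powSucc n)).X k ≃ₗ[ℂ] complexBetti ((B.powSucc m).prod (C.powSucc n)).X k}
    (hg' : g' ∈ powClassStabilizer ((B.powSucc m).prod (C.powSucc n)).X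
      (fun a p ↦ P (cartesianPowDim ((B.powSucc m).prod (C.powSucc n)).dim a) (cartesianPow ((B.powSucc m).prod (C.powSucc n)).X (a + 1)) p)) :
    ∃ (u : complexBetti B.X 1 ≃ₗ[ℂ] complexBetti B.X 1) (v : complexBetti C.X 1 ≃ₗ[ℂ] complexBetti C.X 1),
      (fun k ↦ exteriorPullbackEquiv (AbelianVariety.hasExteriorCohomologyH1_complexPoints (B.prod C)) (prodBlockDiagEquiv u v) k) ∈
          powClassStabilizer (B.prod C).X (fun a p ↦ P (cartesianPowDim (B.prod C).dim a) (cartesianPow (B.prod C).X (a + 1)) p) ∧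
        g' = fun k ↦ exteriorPullbackEquiv (AbelianVariety.hasExteriorCohomologyH1_complexPoints ((B.powSucc m).prod (C.powSucc n)))
          (prodBlockDiagEquiv (diagPow B u m) (diagPow C v n)) k := by
  obtain ⟨U, V, hU, hV, hg'eq⟩ := StabilizerProducts.exists_eq_prodBlockDiagEquiv hS hP (B.powSucc m) (C.powSucc n) hg'
  obtain ⟨g, hg, hgU⟩ := StabilizerPowers.exists_mem_of_mem_powSucc hS hP B m hU
  obtain ⟨k, hk, hkV⟩ := StabilizerPowers.exists_mem_of_mem_powSucc hS hP C n hV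
  -- `U = g₁^{⊕(m+1)}`, `V = k₁^{⊕(n+1)}`
  have hU' : diagPow B (g 1) m = U := by
    have e := congrFun hgU 1
    rwa [Milne1999.diagPowExterior, Milne1999.exteriorPullbackEquiv_one_eq, Milne1999.exteriorPullbackEquiv_one_eq] at e
  have hV' : diagPow C (k 1) n = V := by
    have e := congrFun hkV 1
    rwa [Milne1999.diagPowExterior, Milne1999.exteriorPullbackEquiv_one_eq, Milne1999.exteriorPullbackEquiv_one_eq] at e
  have hgC : g 1 ∈ centralizerGroup B := (StabilizerPowers.eq_exteriorPullbackEquiv_and_mem_centralizerGroup (hS B) hg).2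
  have hkC : k 1 ∈ centralizerGroup C := (StabilizerPowers.eq_exteriorPullbackEquiv_and_mem_centralizerGroup (hS C) hk).2
  refine ⟨g 1, k 1, ?_, by rw [hU', hV']; exact hg'eq⟩
  -- transfer down along `B × C ⊂ B^{m+1} × C^{n+1}`
  obtain ⟨ιB, πB, hB⟩ := Milne1999.exists_section_powSucc B m
  obtain ⟨ιC, πC, hC⟩ := Milne1999.exists_section_powSucc C n
  have hUV : (fun i ↦ exteriorPullbackEquiv (AbelianVariety.hasExteriorCohomologyH1_complexPoints ((B.powSucc m).prod (C.powSucc n)))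
      (prodBlockDiagEquiv (diagPow B (g 1) m) (diagPow C (k 1) n)) i) ∈ powClassStabilizer ((B.powSucc m).prod (C.powSucc n)).X
        (fun a p ↦ P (cartesianPowDim ((B.powSucc m).prod (C.powSucc n)).dim a)
          (cartesianPow ((B.powSucc m).prod (C.powSucc n)).X (a + 1)) p) := by
    rw [hU', hV', ← hg'eq]; exact hg'
  exact StabilizerProducts.mem_of_retraction hS hP
    (AbelianVariety.prodLift (AbelianVariety.fst _ _ ≫ ιB) (AbelianVariety.snd _ _ ≫ ιC))
    (AbelianVariety.prodLift (AbelianVariety.fst _ _ ≫ πB) (AbelianVariety.snd _ _ ≫ πC)) (retraction_prod hB hC)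
    (fun y ↦ intertwine_prod πB πC (diagPow B (g 1) m) (g 1) (diagPow C (k 1) n) (k 1)
      (fun q ↦ Milne1999.diagPow_intertwine_right hgC πB q) (fun z ↦ Milne1999.diagPow_intertwine_right hkC πC z) y) hUV

/-- **`G_P(B^{m+1} × C^{n+1}) = G_P(B × C)` BLOCK-DIAGONALLY, for every admissible class notion `P`** (Moonen–Zarhin §1, `r = 2`, for the
whole Tannaka-free tower): `g' ∈ G_P(B^{m+1} × C^{n+1})` iff `g' = ⋀•(u^{⊕(m+1)} ⊕ v^{⊕(n+1)})` with `⋀•(u ⊕ v) ∈ G_P(B × C)`.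
[cite: MoonenZarhin1999LowDim, §1] [cite: Milne1999LefschetzClasses, Cor. 4.7 and §1 p. 643] [cite: Andre1996Motifs, §6.2–6.3 (p. 31)] -/
theorem mem_iff (B C : AbelianVariety ℂ) (m n : ℕ)
    (g' : ∀ k : ℕ, complexBetti ((B.powSucc m).prod (C.powSucc n)).X k ≃ₗ[ℂ] complexBetti ((B.powSucc m).prod (C.powSucc n)).X k) :
    g' ∈ powClassStabilizer ((B.powSucc m).prod (C.powSucc n)).X
        (fun a p ↦ P (cartesianPowDim ((B.powSucc m).prod (C.powSucc n)).dim a) (cartesianPow ((B.powSucc m).prod (C.powSucc n)).X (a + 1)) p) ↔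
      ∃ (u : complexBetti B.X 1 ≃ₗ[ℂ] complexBetti B.X 1) (v : complexBetti C.X 1 ≃ₗ[ℂ] complexBetti C.X 1),
        (fun k ↦ exteriorPullbackEquiv (AbelianVariety.hasExteriorCohomologyH1_complexPoints (B.prod C)) (prodBlockDiagEquiv u v) k) ∈
            powClassStabilizer (B.prod C).X (fun a p ↦ P (cartesianPowDim (B.prod C).dim a) (cartesianPow (B.prod C).X (a + 1)) p) ∧
          g' = fun k ↦ exteriorPullbackEquiv (AbelianVariety.hasExteriorCohomologyH1_complexPoints ((B.powSucc m).prod (C.powSucc n)))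
            (prodBlockDiagEquiv (diagPow B u m) (diagPow C v n)) k :=
  ⟨exists_of_mem hS hP B C m n, fun ⟨_, _, h, e⟩ ↦ e ▸ diagPow_prodBlockDiagEquiv_mem hS hP B C m n h⟩

end StabilizerProductsPowers

/-! ## §2 Instances: `S`, `G¹_alg`, `G¹_mot` (fact-free), `G¹_AH` (mod c23 + c35 + (E)) -/

section Instances

variable (B C : AbelianVariety ℂ) (m n : ℕ)

/-- **`S(B^{m+1} × C^{n+1}) = S(B × C)` block-diagonally, no hypothesis** (Milne Cor. 4.7 + §1 p. 643 for Milne's Tannaka-free `S`).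
[cite: Milne1999LefschetzClasses, Cor. 4.7 (p. 659) and §1 p. 643] -/
theorem mem_specialLefschetzGroup_powSucc_prod_powSucc_iff
    (g' : ∀ k : ℕ, complexBetti ((B.powSucc m).prod (C.powSucc n)).X k ≃ₗ[ℂ] complexBetti ((B.powSucc m).prod (C.powSucc n)).X k) :
    g' ∈ specialLefschetzGroup ((B.powSucc m).prod (C.powSucc n)).dim ((B.powSucc m).prod (C.powSucc n)).X ↔
      ∃ (u : complexBetti B.X 1 ≃ₗ[ℂ] complexBetti B.X 1) (v : complexBetti C.X 1 ≃ₗ[ℂ] complexBetti C.X 1),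
        (fun k ↦ exteriorPullbackEquiv (AbelianVariety.hasExteriorCohomologyH1_complexPoints (B.prod C)) (prodBlockDiagEquiv u v) k) ∈
            specialLefschetzGroup (B.prod C).dim (B.prod C).X ∧
          g' = fun k ↦ exteriorPullbackEquiv (AbelianVariety.hasExteriorCohomologyH1_complexPoints ((B.powSucc m).prod (C.powSucc n)))
            (prodBlockDiagEquiv (diagPow B u m) (diagPow C v n)) k := by
  have h := @StabilizerProductsPowers.mem_iff (fun N Y p ↦ (divisorClassesSpan Y N p : Set _))
    specialLefschetzGroup_admissibleS divisorClassesSpan_admissibleP B C m n g'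
  exact h

/-- **`G¹_alg(B^{m+1} × C^{n+1}) = G¹_alg(B × C)` block-diagonally, FACT-FREE.** [cite: Andre1996Motifs, §4.6 (ii) and §6.2 (p. 31)]
[cite: MoonenZarhin1999LowDim, §1] -/
theorem mem_algebraicStabilizer_powSucc_prod_powSucc_iff
    (g' : ∀ k : ℕ, complexBetti ((B.powSucc m).prod (C.powSucc n)).X k ≃ₗ[ℂ] complexBetti ((B.powSucc m).prod (C.powSucc n)).X k) :
    g' ∈ algebraicStabilizer ((B.powSucc m).prod (C.powSucc n)).X ↔
      ∃ (u : complexBetti B.X 1 ≃ₗ[ℂ] complexBetti B.X 1) (v : complexBetti C.X 1 ≃ₗ[ℂ] complexBetti C.X 1),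
        (fun k ↦ exteriorPullbackEquiv (AbelianVariety.hasExteriorCohomologyH1_complexPoints (B.prod C)) (prodBlockDiagEquiv u v) k) ∈
            algebraicStabilizer (B.prod C).X ∧
          g' = fun k ↦ exteriorPullbackEquiv (AbelianVariety.hasExteriorCohomologyH1_complexPoints ((B.powSucc m).prod (C.powSucc n)))
            (prodBlockDiagEquiv (diagPow B u m) (diagPow C v n)) k := by
  have h := @StabilizerProductsPowers.mem_iff (fun _ Y p ↦ (algebraicClasses Y p : Set _))
    algebraicStabilizer_admissibleS algebraicClasses_admissibleP B C m n g'
  exact h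

/-- **`G¹_mot(B^{m+1} × C^{n+1}) = G¹_mot(B × C)` block-diagonally, FACT-FREE** (André's special motivated Galois group, Tannaka-free).
[cite: Andre1996Motifs, §4.6 (ii) (p. 24) and §6.2–6.3 (p. 31)] [cite: MoonenZarhin1999LowDim, §1] -/
theorem mem_specialMotivatedGaloisGroup_powSucc_prod_powSucc_iff
    (g' : ∀ k : ℕ, complexBetti ((B.powSucc m).prod (C.powSucc n)).X k ≃ₗ[ℂ] complexBetti ((B.powSucc m).prod (C.powSucc n)).X k) :
    g' ∈ specialMotivatedGaloisGroup ((B.powSucc m).prod (C.powSucc n)).dim ((B.powSucc m).prod (C.powSucc n)).X ↔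
      ∃ (u : complexBetti B.X 1 ≃ₗ[ℂ] complexBetti B.X 1) (v : complexBetti C.X 1 ≃ₗ[ℂ] complexBetti C.X 1),
        (fun k ↦ exteriorPullbackEquiv (AbelianVariety.hasExteriorCohomologyH1_complexPoints (B.prod C)) (prodBlockDiagEquiv u v) k) ∈
            specialMotivatedGaloisGroup (B.prod C).dim (B.prod C).X ∧
          g' = fun k ↦ exteriorPullbackEquiv (AbelianVariety.hasExteriorCohomologyH1_complexPoints ((B.powSucc m).prod (C.powSucc n)))
            (prodBlockDiagEquiv (diagPow B u m) (diagPow C v n)) k := by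
  have h := @StabilizerProductsPowers.mem_iff (fun N Y p ↦ (motivatedClasses N Y p : Set _))
    specialMotivatedGaloisGroup_admissibleS motivatedClasses_admissibleP B C m n g'
  exact h

/-- **`G¹_AH(B^{m+1} × C^{n+1}) = G¹_AH(B × C)` block-diagonally — THE ROW'S GROUP** (mod c23 = V-B3 `hZ`, c35 = (N) `hN`, (E) `hex`,
displayed). [cite: Deligne1982HodgeCycles, I §3 Thm. 3.8 and §2 Ex. 2.1 (a)] [cite: CharlesSchnell2014Notes, §11.2.2 (11.2.2)–(11.2.3)]
[cite: MoonenZarhin1999LowDim, §1] -/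
theorem mem_absoluteHodgeStabilizer_powSucc_prod_powSucc_iff (hZ : deligne1982_cycleClass_absoluteHodge) (hN : chartConjugation_canonical)
    (hex : ∀ ⦃n : ℕ⦄ ⦃X : SchemeOver ℂ⦄, IsSmoothProjective n X →
      ∀ (σ : ℂ ≃+* ℂ) (p : ℕ) (c : complexBetti X (2 * p)), ∃ s, IsConjugateClass σ X (2 * p) c s)
    (g' : ∀ k : ℕ, complexBetti ((B.powSucc m).prod (C.powSucc n)).X k ≃ₗ[ℂ] complexBetti ((B.powSucc m).prod (C.powSucc n)).X k) :
    g' ∈ powClassStabilizer ((B.powSucc m).prod (C.powSucc n)).X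
        (fun a p ↦ {c : complexBetti (cartesianPow ((B.powSucc m).prod (C.powSucc n)).X (a + 1)) (2 * p) |
          IsAbsoluteHodgeClass (cartesianPowDim ((B.powSucc m).prod (C.powSucc n)).dim a)
            (cartesianPow ((B.powSucc m).prod (C.powSucc n)).X (a + 1)) p c}) ↔
      ∃ (u : complexBetti B.X 1 ≃ₗ[ℂ] complexBetti B.X 1) (v : complexBetti C.X 1 ≃ₗ[ℂ] complexBetti C.X 1),
        (fun k ↦ exteriorPullbackEquiv (AbelianVariety.hasExteriorCohomologyH1_complexPoints (B.prod C)) (prodBlockDiagEquiv u v) k) ∈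
            powClassStabilizer (B.prod C).X (fun a p ↦ {c : complexBetti (cartesianPow (B.prod C).X (a + 1)) (2 * p) |
              IsAbsoluteHodgeClass (cartesianPowDim (B.prod C).dim a) (cartesianPow (B.prod C).X (a + 1)) p c}) ∧
          g' = fun k ↦ exteriorPullbackEquiv (AbelianVariety.hasExteriorCohomologyH1_complexPoints ((B.powSucc m).prod (C.powSucc n)))
            (prodBlockDiagEquiv (diagPow B u m) (diagPow C v n)) k :=
  @StabilizerProductsPowers.mem_iff (fun N Y p ↦ {c : complexBetti Y (2 * p) | IsAbsoluteHodgeClass N Y p c})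
    (absoluteHodgeStabilizer_admissibleS hZ) (absoluteHodgeClasses_admissibleP hN hex) B C m n g'

end Instances

end Summit.HodgeConjecture.HodgeConjecture.Ring2.Hypotheses

end
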